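/- Copyright: the b2b-balaban cell (near-miss cell 7), T⁴-continuum fan-out, row NE7b CRUX team (2), seat
`t4-ne7b-formalise-leaf-03` (gen 129) — typist's build of the OWNER's INTERFACE REQUEST NE7b IR-103-1 «THE END RE-CUT AT THE PER-CLASS
RELATIVE DISPLAY» (OWNER `t4-ne7b-p1` g103, rulings W-ne7bp1-g103-1 §4 (3) ∕ W-ne7bp1-g103-2 (4)), part 2 of 2: the road.  Released under
the licence of the surrounding project. -/
import Summits.QuantumFields.BalabanUV.T4Continuum.Support.B16HistoryTowerExtractionDataLWR
import Summits.QuantumFields.BalabanUV.T4Continuum.Spine.NE7b.PinnedExtraction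

/-!
# (α)-INSTANCE — THE END AT THE TOWER, RE-CUT AT THE PER-PINNED-CLASS RELATIVE DISPLAY, part 2: the road
`continuumYM4Torus_of_towerExtraction_fsc` := `PinnedExtraction.exists_relWeightBound_of_extraction_majorant` → the seam (ζ′)
`CountSeamJunction.hybridNE7_of_eventually` → the structure-free apex step `stringHybridNE7_of_hybridNE7_repr` → `T4ApexHybrid` →
`T4ContinuumYM4Torus.continuumYM4Torus_of_targets`, every link BY NAME

Summits-side support leaf of the T⁴-continuum cell (rung (B)+1 on a FINITE torus only; NOT infinite volume, NOT the mass gap, NOT Clay; NOT a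
proof of NE7b — the cell's OWN estimate `T4WeightBudget.RelWeightBound`, NOT PRINTED, NOT PROVED).  [folklore] composition BY NAME over part 1's
record `TowerExtractionDataLWR`: eleven theorems, no `def`, no `[cite:]` tag, no `Prop` minted, zero `sorry`.  INTERFACE REQUEST NE7b IR-103-1 (OWNER
`t4-ne7b-p1` g103), second half; typist leaf-03 g129 (INTENT I-leaf03-g129-1, journal l.50091).
WHAT.  §0 two structure-free helpers: `relWeightBound_raise` (the eventual shape of `T4WeightBudget.relWeightBound_of_eventually` survives RAISING
its threshold when the bad sets agree above the new one and the weight is summable) and `exists_mem_badGMems_mem_fibre` (the E-side kernel fact on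
the carrier, leaf-02 g117's reading (T2): a term of the budget's saturated bad set `badOfClass (bstrOf sh mem) T (badClasses sh mem j⋆ T)` lies in
the fibre of its own key, a bad key `∈ badGMems mem j⋆ T gmem K` — `mem_badOfClass` ∕ `HistoryAssemblyMult.mem_badTerms_of_mem_fibre` ∕
`mem_badGMems_of_mem`).  §1 over a record `Sd` (`T† := HIndex.termSet (skelFam Sd.T Sd.p₀)`, `RA := reprFam … (fun _ _ => 1) _`, weights `≥ 0` by
`weight_nonneg` ∕ `weightB_nonneg` since `χ ≡ 1`): **`extractionLawsA ∕ extractionLawsB`** — `PinnedExtraction.ExtractionLaws Sd.l₀ T† A Bad⁺ X⁺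
(fibre …) Sd.qA` (resp. `weightB μ RA Sd.trunc`, `Sd.qB`) with the budget's bad set and the bad keys EMPTIED below `Sd.K₀` (`Bad⁺`, `X⁺`), cover
by §0, display `Sd.extractA` (resp. `Sd.extractB` moved to run A's index by `B16HistoryIndexedTrunc.sum_fibre_aggW_eq` ∕ `sum_aggW_eq (Sd.htr K
hK)`); **`relWeightBound_of_towerExtraction`** — `∃ K₁ ≥ Sd.K₀, RelWeightBound Sd.l₀ T† A B (if K₁ ≤ K then badOfClass … else ∅) (indicator {K₁ ≤ K}
(V · rq ^ (K − jhalf K)))` (`exists_relWeightBound_of_extraction_majorant` at `c := 1∕2`, `hfrac := T4RenewalChains.half_le_sub_jhalf`, counts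
`Sd.countA ∕ countB`; then §0's raise to `max K₀′ Sd.K₀`); **`hybridNE7_of_towerExtraction`** (`CountSeamJunction.hybridNE7_of_eventually` with
`Sd.shell`, `Sd.budget`, `Sd.sum_*`); **`stringHybridNE7_of_towerExtraction`** (`HistoryRealiseCellsRunApexT3b.stringHybridNE7_of_hybridNE7_repr`
with the FAMILY's E1∕E2 identities: `Sd.H2A` ⬝ `Repr172R.integral_eq_sum_weight` at `holdsFam` ∕ `Sd.intA`, and at cutoff `K + 1`
`B16HistoryIndexedTrunc.reprB_of_holds_trunc` with `Sd.htr`).  §2 **`stringwise_of_towerExtraction`**, **`hybridNE7Under_of_towerExtraction_fsc`**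
(PIN-FREE: `ForSmallCouplings.mono` ∕ `.underHypotheses`, the pattern of `HistoryChessboardApex`), and for (0.4)-block-averaged data on `SU(N)` the
terminal theorem **`continuumYM4Torus_of_towerExtraction_fsc (D) (hBA) (hE) (hB) (hβ) (hRead)`** (`T4ApexHybrid.targets_of_hybridNE7Under`, then
`T4ContinuumYM4Torus.continuumYM4Torus_of_targets` — the pins `(B)` ∕ `BetaPertHyp` are consumed THERE ONLY) and its print-faithful twin
**`continuumYM4Torus_of_towerExtraction_fsc'`** (β-pin `DagBinding.EndpointExistence D.C.toB12`; leaf-02 g119's J-X2-1).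
NOT A BINDER ANY MORE (typist's located choice C-4): the siblings' `ThresholdOK ∕ hμ ∕ hκ₁ ∕ hE₀ ∕ hA₀ ∕ hβ₀ ∕ hLβ ∕ hn₁ ∕ hθ ∕ hslack ∕ hsS ∕ hsmall ∕
hθc…` priced the COUNT inside the pinned END; here the count is the record's displayed `countA ∕ countB` (task T-g103-1 of its custodians).
NET, HONEST: a consumer holding, for all small-coupling tuned runs and every loop string, (A1c)'s tower family AT PRINT's LIVE INDEX with the two
EXTRACTION displays per pinned old genealogy (H3^NE7b at the partial sums — print's KIND, NOT print's statement), the cell's COUNT in relative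
currency, NE7c's shell, NE7's budget and four summable rates (plus the displayed-only rows) gets the headline predicate with no lemma application
of its own; nothing of Bałaban's asserted, valued or discharged; BY-NAME EFFECT ON THE WALL: NONE (the (α) road now OWES `extractA ∕ extractB` +
the identification + the count, no longer `hBA ∕ hWi ∕ (ρ)`); NE7b NOT proved; count 0∕9.  HONEST DEPENDENCY (cell): continuum YM on T⁴ ⇐
BetaPertH ∧ nine spine estimates (0/9 proved); BetaPertH ⇐ (D1) ∧ (D4) ∧ CAP+tail; G-an2-4 gates asym, D1 and NE2/3/4.  Unchanged here.
-/


open Finset MeasureTheory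
open Literature.MathematicalPhysics.QuantumFieldTheory.Balaban1983to89 T4PersistenceDictionary T4PersistentHistoryCount T4PrintedShapeBanking
open T4WeightBudget T4LiveClassFibration T4IndicatorShell T4MatchingAssembly T4MatchingClosure T4MatchingClosureSocket T4Continuum T4RenewalChains
open Summit.QuantumFields.BalabanUV.T4Continuum.CountSeamJunction Summit.QuantumFields.BalabanUV.T4Continuum.HistoryFlow
open Summit.QuantumFields.BalabanUV.T4Continuum.HistoryConstants
open Summit.QuantumFields.BalabanUV.T4Continuum.HistorySocketTH Summit.QuantumFields.BalabanUV.T4Continuum.HistoryAssemblyTerms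
open Summit.QuantumFields.BalabanUV.T4Continuum.HistoryAssemblyMult Summit.QuantumFields.BalabanUV.T4Continuum.HistoryAssemblyMultKey
open Summit.QuantumFields.BalabanUV.T4Continuum.HistoryRealiseCellsRunApexT3b Summit.QuantumFields.BalabanUV.T4Continuum.HistoryGenealogyRealise
open Summit.QuantumFields.BalabanUV.T4Continuum.HistoryGenealogyInstantiate Summit.QuantumFields.BalabanUV.T4Continuum.B16HistoryIndexedRepr
open Summit.QuantumFields.BalabanUV.T4Continuum.B16HistoryIndexedTrunc Summit.QuantumFields.BalabanUV.T4Continuum.HistoryRealiseCellsRunAssemblyWTVSData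
open Summit.QuantumFields.BalabanUV.T4Continuum.B16HistoryReprChain Summit.QuantumFields.BalabanUV.T4Continuum.B16HistoryReprInstance
open Summit.QuantumFields.BalabanUV.T4Continuum.NE7b.PinnedExtraction
open Summit.QuantumFields.BalabanUV.T4Continuum.B16HistoryTowerExtractionDataLWR

namespace Summit.QuantumFields.BalabanUV.T4Continuum.B16HistoryTowerExtractionEnd

noncomputable section

set_option synthInstance.maxSize 1024

/-! ## §0 Two structure-free helpers -/

section Helpers

variable {ι : Type*} {l₀ : ℝ} {T : ℕ → Finset ι} {A B : ℕ → ℝ → ι → ℝ}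

/-- **THRESHOLD RAISE** for the eventual shape of `T4WeightBudget.relWeightBound_of_eventually`: a `RelWeightBound` with bad classes `Bad′`
emptied and weight zeroed below `K₀` gives, for `K₁ ≥ K₀` and a summable weight, the same shape at `K₁` with ANY bad classes `Bad` that agree
with `Bad′` from `K₁` on. [folklore] -/
theorem relWeightBound_raise {Bad Bad' : ℕ → ℝ → Finset ι} {W : ℕ → ℝ} {K₀ K₁ : ℕ} (hK : K₀ ≤ K₁) (hs : Summable W)
    (h : RelWeightBound l₀ T A B (fun K t => if K₀ ≤ K then Bad' K t else ∅) (Set.indicator {K | K₀ ≤ K} W))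
    (hBB : ∀ K t, K₁ ≤ K → Bad' K t = Bad K t) :
    RelWeightBound l₀ T A B (fun K t => if K₁ ≤ K then Bad K t else ∅) (Set.indicator {K | K₁ ≤ K} W) := by
  have hmem : ∀ K, K₁ ≤ K → K ∈ {K | K₀ ≤ K} := fun K hK1 => hK.trans hK1
  refine relWeightBound_of_eventually (fun K t ht hK1 => ?_) (fun K hK1 => ?_) (fun K hK1 => ?_) hs
    (fun K t ht hK1 => ?_) (fun K t ht hK1 => ?_)
  · have h1 := h.bad_subset K t ht
    simp only [if_pos (hK.trans hK1)] at h1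
    rw [hBB K t hK1] at h1
    exact h1
  · have h1 := h.nonneg K
    rwa [Set.indicator_of_mem (hmem K hK1)] at h1
  · have h1 := h.lt_one K
    rwa [Set.indicator_of_mem (hmem K hK1)] at h1
  · have h1 := h.bad_left K t ht
    simp only [if_pos (hK.trans hK1), Set.indicator_of_mem (hmem K hK1)] at h1
    rw [hBB K t hK1] at h1
    exact h1
  · have h1 := h.bad_right K t ht
    simp only [if_pos (hK.trans hK1), Set.indicator_of_mem (hmem K hK1)] at h1
    rw [hBB K t hK1] at h1
    exact h1

/-- **THE COVER OF THE BUDGET's BAD SET BY THE KEY FIBRES** (E-side kernel fact on the carrier; leaf-02 g117's reading (T2)): a term of the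
saturated bad set cut out by the bad slot-family classes is a bad term (`HistoryAssemblyMult.mem_badTerms_of_mem_fibre`), so its own key is a
bad key (`mem_badGMems_of_mem`) and the term lies in that key's fibre. [folklore] -/
theorem exists_mem_badGMems_mem_fibre {ε γ κ ω : Type*} [DecidableEq γ] [DecidableEq ε] [DecidableEq ω] {sh : ε → PEv}
    {mem : ℕ → κ → Finset (γ × Gen ε)} {jstar : ℕ → ℕ} {S : ℕ → Finset κ} {gmem : ℕ → κ → Finset ω} {K : ℕ} {t : ℝ} {τ : κ}
    (hτ : τ ∈ badOfClass (bstrOf sh mem) S (fun K _ => badClasses sh mem jstar S K) K t) :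
    ∃ k ∈ badGMems mem jstar S gmem K, τ ∈ fibre gmem S K k := by
  obtain ⟨hT, hc⟩ := mem_badOfClass.1 hτ
  obtain ⟨hbad, -⟩ := mem_badTerms_of_mem_fibre hc (mem_fibre.2 ⟨hT, rfl⟩)
  exact ⟨gmem K τ, mem_badGMems_of_mem hbad, mem_fibre.2 ⟨hT, rfl⟩⟩

end Helpers

/-! ## §1 Over one record: the extraction laws of both runs, the `RelWeightBound`, the seam, the apex's per-string datum -/

section Road

variable {F : T4Family} {G : Type*} [GaugeGroup G] [MeasurableSpace G] [HaarData G]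
  {D : FiniteEpsData F G} {C : T4PrintedShapeBanking.Consts} {O : PrintedO1s} {θv : ℝ} {rr d n : ℕ} {hn : 0 < n}
  {g₀ : ℕ → ℝ} {os : List (ULoop F)} {cΛ M Φ β₀ : ℝ} {p₁ η η' κ κ₂ κᵥ : ℕ}
  {P : Type} [DecidableEq P] {X : ℕ → ℕ → Type} {𝒢 : (K j : ℕ) → GoodClass (X K j)}
  [∀ K, MeasurableSpace (X K K)] {μ : (K : ℕ) → Measure (X K K)} [∀ K, IsFiniteMeasure (μ K)]

/-- **RUN A's EXTRACTION LAWS AT THE TOWER** (`PinnedExtraction.ExtractionLaws`): term sets `T†`, weights M2-A's, bad classes the budget's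
saturated bad set and pinned classes the bad keys — both EMPTIED below `Sd.K₀` —, sub-classes the key fibres, quotients `Sd.qA`; the cover is
§0's kernel fact, the display is `Sd.extractA`. [folklore] -/
theorem extractionLawsA (Sd : TowerExtractionDataLWR D C O θv rr d n hn g₀ os cΛ M Φ β₀ p₁ η η' κ κ₂ κᵥ P X 𝒢 μ) :
    ExtractionLaws Sd.l₀ (HIndex.termSet (skelFam Sd.T Sd.p₀))
      (fun _ t => Repr172R.weight μ (reprFam Sd.T Sd.p₀ Sd.ρ₀ Sd.hρ₀ Sd.h0 (fun _ _ => 1) (fun _ _ => one_pos)) t)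
      (fun K t => if Sd.K₀ ≤ K then
        badOfClass (bstrOf Prod.fst (memA n F.L (Sd.𝒮.reading Sd.T Sd.p₀))) (HIndex.termSet (skelFam Sd.T Sd.p₀))
          (fun K _ => badClasses Prod.fst (memA n F.L (Sd.𝒮.reading Sd.T Sd.p₀)) jhalf (HIndex.termSet (skelFam Sd.T Sd.p₀)) K) K t
        else ∅)
      (fun K => if Sd.K₀ ≤ K then
        badGMems (memA n F.L (Sd.𝒮.reading Sd.T Sd.p₀)) jhalf (HIndex.termSet (skelFam Sd.T Sd.p₀))
          (kmemA n F.L hn (lt_of_lt_of_le (by norm_num) (two_le_L F)) (Sd.𝒮.reading Sd.T Sd.p₀)) K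
        else ∅)
      (fun K k => fibre (kmemA n F.L hn (lt_of_lt_of_le (by norm_num) (two_le_L F)) (Sd.𝒮.reading Sd.T Sd.p₀))
        (HIndex.termSet (skelFam Sd.T Sd.p₀)) K k)
      Sd.qA where
  bad_subset K t _ := by
    by_cases hK : Sd.K₀ ≤ K
    · simp only [if_pos hK]; exact badOfClass_subset K t
    · simp only [if_neg hK]; exact Finset.empty_subset _
  cover K t _ τ hτ := by
    by_cases hK : Sd.K₀ ≤ K
    · simp only [if_pos hK] at hτ ⊢
      exact exists_mem_badGMems_mem_fibre hτ
    · simp only [if_neg hK] at hτ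
      exact absurd hτ (Finset.notMem_empty τ)
  q_nonneg K k hk := by
    by_cases hK : Sd.K₀ ≤ K
    · simp only [if_pos hK] at hk; exact Sd.qA_nonneg K hK k hk
    · simp only [if_neg hK] at hk; exact absurd hk (Finset.notMem_empty k)
  extract K t ht k hk := by
    by_cases hK : Sd.K₀ ≤ K
    · simp only [if_pos hK] at hk; exact Sd.extractA K t ht hK k hk
    · simp only [if_neg hK] at hk; exact absurd hk (Finset.notMem_empty k)

/-- **RUN B's EXTRACTION LAWS AT THE TOWER, AT RUN A's INDEX**: the same carrier data with run B's weights after node O's partial summation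
`weightB μ RA Sd.trunc` and quotients `Sd.qB`; the display is `Sd.extractB` (run B's own terms through `trunc`) moved to run A's index by
`B16HistoryIndexedTrunc.sum_fibre_aggW_eq` (fibre side) and `sum_aggW_eq (Sd.htr K hK)` (full sum). [folklore] -/
theorem extractionLawsB (Sd : TowerExtractionDataLWR D C O θv rr d n hn g₀ os cΛ M Φ β₀ p₁ η η' κ κ₂ κᵥ P X 𝒢 μ) :
    ExtractionLaws Sd.l₀ (HIndex.termSet (skelFam Sd.T Sd.p₀))
      (weightB μ (reprFam Sd.T Sd.p₀ Sd.ρ₀ Sd.hρ₀ Sd.h0 (fun _ _ => 1) (fun _ _ => one_pos)) Sd.trunc)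
      (fun K t => if Sd.K₀ ≤ K then
        badOfClass (bstrOf Prod.fst (memA n F.L (Sd.𝒮.reading Sd.T Sd.p₀))) (HIndex.termSet (skelFam Sd.T Sd.p₀))
          (fun K _ => badClasses Prod.fst (memA n F.L (Sd.𝒮.reading Sd.T Sd.p₀)) jhalf (HIndex.termSet (skelFam Sd.T Sd.p₀)) K) K t
        else ∅)
      (fun K => if Sd.K₀ ≤ K then
        badGMems (memA n F.L (Sd.𝒮.reading Sd.T Sd.p₀)) jhalf (HIndex.termSet (skelFam Sd.T Sd.p₀))
          (kmemA n F.L hn (lt_of_lt_of_le (by norm_num) (two_le_L F)) (Sd.𝒮.reading Sd.T Sd.p₀)) K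
        else ∅)
      (fun K k => fibre (kmemA n F.L hn (lt_of_lt_of_le (by norm_num) (two_le_L F)) (Sd.𝒮.reading Sd.T Sd.p₀))
        (HIndex.termSet (skelFam Sd.T Sd.p₀)) K k)
      Sd.qB where
  bad_subset K t _ := by
    by_cases hK : Sd.K₀ ≤ K
    · simp only [if_pos hK]; exact badOfClass_subset K t
    · simp only [if_neg hK]; exact Finset.empty_subset _
  cover K t _ τ hτ := by
    by_cases hK : Sd.K₀ ≤ K
    · simp only [if_pos hK] at hτ ⊢
      exact exists_mem_badGMems_mem_fibre hτ
    · simp only [if_neg hK] at hτ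
      exact absurd hτ (Finset.notMem_empty τ)
  q_nonneg K k hk := by
    by_cases hK : Sd.K₀ ≤ K
    · simp only [if_pos hK] at hk; exact Sd.qB_nonneg K hK k hk
    · simp only [if_neg hK] at hk; exact absurd hk (Finset.notMem_empty k)
  extract K t ht k hk := by
    by_cases hK : Sd.K₀ ≤ K
    · simp only [if_pos hK] at hk
      rw [weightB, sum_fibre_aggW_eq,
        sum_aggW_eq (S := fun K => HIndex.termSet (skelFam Sd.T Sd.p₀) (K + 1))
          (w := fun _ t τ' => Repr172R.weight μ (reprFam Sd.T Sd.p₀ Sd.ρ₀ Sd.hρ₀ Sd.h0 (fun _ _ => 1) (fun _ _ => one_pos)) t τ')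
          (Sd.htr K hK)]
      exact Sd.extractB K t ht hK k hk
    · simp only [if_neg hK] at hk; exact absurd hk (Finset.notMem_empty k)

/-- **THE `RelWeightBound` AT THE HONEST CUT, FROM THE RECORD**: both runs' extraction laws + the counts under the two-rate majorant
(`PinnedExtraction.exists_relWeightBound_of_extraction_majorant` at `c := 1∕2`, `hfrac := T4RenewalChains.half_le_sub_jhalf`), the threshold
then raised to `max · Sd.K₀` (§0) so that the bad classes are the budget's OWN saturated bad set from the threshold on. [folklore] -/
theorem relWeightBound_of_towerExtraction (Sd : TowerExtractionDataLWR D C O θv rr d n hn g₀ os cΛ M Φ β₀ p₁ η η' κ κ₂ κᵥ P X 𝒢 μ) :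
    ∃ K₁, Sd.K₀ ≤ K₁ ∧ RelWeightBound Sd.l₀ (HIndex.termSet (skelFam Sd.T Sd.p₀))
      (fun _ t => Repr172R.weight μ (reprFam Sd.T Sd.p₀ Sd.ρ₀ Sd.hρ₀ Sd.h0 (fun _ _ => 1) (fun _ _ => one_pos)) t)
      (weightB μ (reprFam Sd.T Sd.p₀ Sd.ρ₀ Sd.hρ₀ Sd.h0 (fun _ _ => 1) (fun _ _ => one_pos)) Sd.trunc)
      (fun K t => if K₁ ≤ K then
        badOfClass (bstrOf Prod.fst (memA n F.L (Sd.𝒮.reading Sd.T Sd.p₀))) (HIndex.termSet (skelFam Sd.T Sd.p₀))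
          (fun K _ => badClasses Prod.fst (memA n F.L (Sd.𝒮.reading Sd.T Sd.p₀)) jhalf (HIndex.termSet (skelFam Sd.T Sd.p₀)) K) K t
        else ∅)
      (Set.indicator {K | K₁ ≤ K} fun K => Sd.V * Sd.rq ^ (K - jhalf K)) := by
  have hmajA : ∀ K, ∑ k ∈ (if Sd.K₀ ≤ K then
      badGMems (memA n F.L (Sd.𝒮.reading Sd.T Sd.p₀)) jhalf (HIndex.termSet (skelFam Sd.T Sd.p₀))
        (kmemA n F.L hn (lt_of_lt_of_le (by norm_num) (two_le_L F)) (Sd.𝒮.reading Sd.T Sd.p₀)) K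
      else ∅), Sd.qA K k ≤ Sd.V * Sd.rq ^ (K - jhalf K) := fun K => by
    by_cases hK : Sd.K₀ ≤ K
    · simp only [if_pos hK]; exact Sd.countA K hK
    · simp only [if_neg hK, Finset.sum_empty]; exact mul_nonneg Sd.hV (pow_nonneg Sd.hrq0.le _)
  have hmajB : ∀ K, ∑ k ∈ (if Sd.K₀ ≤ K then
      badGMems (memA n F.L (Sd.𝒮.reading Sd.T Sd.p₀)) jhalf (HIndex.termSet (skelFam Sd.T Sd.p₀))
        (kmemA n F.L hn (lt_of_lt_of_le (by norm_num) (two_le_L F)) (Sd.𝒮.reading Sd.T Sd.p₀)) K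
      else ∅), Sd.qB K k ≤ Sd.V * Sd.rq ^ (K - jhalf K) := fun K => by
    by_cases hK : Sd.K₀ ≤ K
    · simp only [if_pos hK]; exact Sd.countB K hK
    · simp only [if_neg hK, Finset.sum_empty]; exact mul_nonneg Sd.hV (pow_nonneg Sd.hrq0.le _)
  obtain ⟨K₀', h⟩ := exists_relWeightBound_of_extraction_majorant (extractionLawsA Sd) (extractionLawsB Sd)
    (fun _ t _ τ => Repr172R.weight_nonneg μ _ t (fun _ _ _ => zero_le_one) τ)
    (fun K t _ τ => weightB_nonneg μ _ Sd.trunc K t (fun _ _ _ => zero_le_one) τ) Sd.hrq0 Sd.hrq1 Sd.hV one_half_pos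
    half_le_sub_jhalf hmajA hmajB
  refine ⟨max K₀' Sd.K₀, le_max_right _ _, relWeightBound_raise (le_max_left _ _)
    (summable_weightMajorant Sd.hrq0 Sd.hrq1 Sd.hV one_half_pos half_le_sub_jhalf) h fun K t hK => ?_⟩
  simp only [if_pos (le_trans (le_max_right _ _) hK)]

/-- **THE SEAM (ζ′) BY NAME**: the record's `RelWeightBound` (previous theorem), NE7c's `Sd.shell`, NE7's `Sd.budget` on the hybrid cores and the
four summable rates give `HybridNE7` for the families shifted by `K₁ + K₂`, some `K₁ ≥ Sd.K₀` (`CountSeamJunction.hybridNE7_of_eventually`).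
[folklore] -/
theorem hybridNE7_of_towerExtraction (Sd : TowerExtractionDataLWR D C O θv rr d n hn g₀ os cΛ M Φ β₀ p₁ η η' κ κ₂ κᵥ P X 𝒢 μ) :
    ∃ K₁ K₂, Sd.K₀ ≤ K₁ ∧ HybridNE7 Sd.l₀ Sd.vol (fun K => HIndex.termSet (skelFam Sd.T Sd.p₀) (K₁ + (K₂ + K)))
      (fun _ t => Repr172R.weight μ (reprFam Sd.T Sd.p₀ Sd.ρ₀ Sd.hρ₀ Sd.h0 (fun _ _ => 1) (fun _ _ => one_pos)) t)
      (fun K => weightB μ (reprFam Sd.T Sd.p₀ Sd.ρ₀ Sd.hρ₀ Sd.h0 (fun _ _ => 1) (fun _ _ => one_pos)) Sd.trunc (K₁ + (K₂ + K)))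
      (fun K => badOfClass (bstrOf Prod.fst (memA n F.L (Sd.𝒮.reading Sd.T Sd.p₀))) (HIndex.termSet (skelFam Sd.T Sd.p₀))
          (fun K _ => badClasses Prod.fst (memA n F.L (Sd.𝒮.reading Sd.T Sd.p₀)) jhalf (HIndex.termSet (skelFam Sd.T Sd.p₀)) K)
          (K₁ + (K₂ + K)))
      (fun K => Sd.V * Sd.rq ^ (K₁ + (K₂ + K) - jhalf (K₁ + (K₂ + K))))
      (fun K => Sd.shA (K₁ + (K₂ + K))) (fun K => Sd.shB (K₁ + (K₂ + K))) (fun K => Sd.Wsh (K₁ + (K₂ + K)))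
      (fun K => (Sd.r (K₁ + (K₂ + K)) + Sd.u (K₁ + (K₂ + K))) + (Sd.s (K₁ + (K₂ + K)) + Sd.s₂ (K₁ + (K₂ + K)))) :=
  hybridNE7_of_eventually (relWeightBound_of_towerExtraction Sd) Sd.shell Sd.budget Sd.sum_r Sd.sum_u Sd.sum_s Sd.sum_s₂

/-- **ONE STRING: THE RECORD ⇒ THE APEX's PER-STRING HYBRID-NE7 DATUM** `StringHybridNE7 (D.scheme g₀) os Sd.l₀ Sd.vol K` for some `K ≥ Sd.K₀` —
the seam's output fed to the structure-free apex step `HistoryRealiseCellsRunApexT3b.stringHybridNE7_of_hybridNE7_repr` with the E1∕E2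
identities OF THE FAMILY: run A by `Sd.H2A` and M2-A's `Repr172R.integral_eq_sum_weight` at `holdsFam` ∕ `Sd.intA`; run B (the family at cutoff
`K + 1`) by `Sd.H2A (K + 1)` and `B16HistoryIndexedTrunc.reprB_of_holds_trunc` with `Sd.htr`. [folklore] -/
theorem stringHybridNE7_of_towerExtraction
    (Sd : TowerExtractionDataLWR D C O θv rr d n hn g₀ os cΛ M Φ β₀ p₁ η η' κ κ₂ κᵥ P X 𝒢 μ) :
    ∃ K, Sd.K₀ ≤ K ∧ StringHybridNE7 (D.scheme g₀) os Sd.l₀ Sd.vol K := by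
  obtain ⟨K₁, K₂, hK₁, hH⟩ := hybridNE7_of_towerExtraction Sd
  have reprA : ∀ K t, |t| ≤ Sd.l₀ → Sd.K₀ ≤ K →
      ∫ U, Real.exp (t * T4GenFunBounds.prodObs (D.scheme g₀) K os U) * D.dens K (g₀ K) 0 U ∂fieldMeasure (F.P K) 0 G =
        ∑ τ ∈ HIndex.termSet (skelFam Sd.T Sd.p₀) K,
          Repr172R.weight μ (reprFam Sd.T Sd.p₀ Sd.ρ₀ Sd.hρ₀ Sd.h0 (fun _ _ => 1) (fun _ _ => one_pos)) t τ :=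
    fun K t ht hK => (Sd.H2A K t ht hK).trans
      (Repr172R.integral_eq_sum_weight μ (reprFam Sd.T Sd.p₀ Sd.ρ₀ Sd.hρ₀ Sd.h0 (fun _ _ => 1) (fun _ _ => one_pos)) K t
        (densFam Sd.T Sd.ρ₀ K t) (holdsFam Sd.T Sd.p₀ Sd.ρ₀ Sd.hρ₀ Sd.h0 (fun _ _ => 1) (fun _ _ => one_pos) Sd.hp₀ K t)
        (Sd.intA K t))
  have reprB : ∀ K t, |t| ≤ Sd.l₀ → Sd.K₀ ≤ K →
      ∫ U, Real.exp (t * T4GenFunBounds.prodObs (D.scheme g₀) (K + 1) os U) * D.dens (K + 1) (g₀ (K + 1)) 0 U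
          ∂fieldMeasure (F.P (K + 1)) 0 G =
        ∑ τ ∈ HIndex.termSet (skelFam Sd.T Sd.p₀) K,
          weightB μ (reprFam Sd.T Sd.p₀ Sd.ρ₀ Sd.hρ₀ Sd.h0 (fun _ _ => 1) (fun _ _ => one_pos)) Sd.trunc K t τ :=
    fun K t ht hK => (Sd.H2A (K + 1) t ht (Nat.le_succ_of_le hK)).trans
      (reprB_of_holds_trunc μ (reprFam Sd.T Sd.p₀ Sd.ρ₀ Sd.hρ₀ Sd.h0 (fun _ _ => 1) (fun _ _ => one_pos)) Sd.trunc K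
        (fun t => ∫ x, densFam Sd.T Sd.ρ₀ (K + 1) t x ∂μ (K + 1)) (densFam Sd.T Sd.ρ₀ (K + 1)) (fun _ => rfl)
        (holdsFam Sd.T Sd.p₀ Sd.ρ₀ Sd.hρ₀ Sd.h0 (fun _ _ => 1) (fun _ _ => one_pos) Sd.hp₀ (K + 1)) (Sd.intA (K + 1))
        (Sd.htr K hK) t)
  exact ⟨K₁ + K₂, hK₁.trans (Nat.le_add_right _ _), stringHybridNE7_of_hybridNE7_repr D reprA reprB hK₁ hH⟩

end Road

/-! ## §2 Under the prefix: the apex input PIN-FREE, then the four targets and the headline for printed data on `SU(N)` -/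

section Under

variable {F : T4Family} {G : Type*} [GaugeGroup G] [MeasurableSpace G] [HaarData G] {D : FiniteEpsData F G}
  {C : T4PrintedShapeBanking.Consts} {O : PrintedO1s} {θv : ℝ} {rr d n : ℕ} {hn : 0 < n} {g₀ : ℕ → ℝ} {cΛ M Φ β₀ : ℝ}
  {p₁ η η' κ κ₂ κᵥ : ℕ}

/-- **ONE TUNED RUN: a record for EVERY loop string ⇒ `StringwiseHybridNE7 (D.scheme g₀)`** (node U5's per-string output shape of the apex
lineage, `T4ApexHybrid`; radius `Sd.l₀`, volume factor `Sd.vol` per string). [folklore] -/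
theorem stringwise_of_towerExtraction
    (h : ∀ os : List (ULoop F), ∃ (P : Type) (_ : DecidableEq P) (X : ℕ → ℕ → Type) (𝒢 : (K j : ℕ) → GoodClass (X K j))
      (_ : ∀ K, MeasurableSpace (X K K)) (μ : (K : ℕ) → Measure (X K K)) (_ : ∀ K, IsFiniteMeasure (μ K)),
      Nonempty (TowerExtractionDataLWR D C O θv rr d n hn g₀ os cΛ M Φ β₀ p₁ η η' κ κ₂ κᵥ P X 𝒢 μ)) :
    T4ApexHybrid.StringwiseHybridNE7 (D.scheme g₀) := fun os => by
  obtain ⟨P, _, X, 𝒢, _, μ, _, ⟨Sd⟩⟩ := h os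
  obtain ⟨K, -, hK⟩ := stringHybridNE7_of_towerExtraction Sd
  exact ⟨Sd.l₀, Sd.vol, K, Sd.l₀_pos, Sd.vol_pos, hK⟩

variable (D) in
/-- **ROW NE7b, (α) ROAD RE-CUT, AT THE APEX — PIN-FREE: `HybridNE7Under D Hβ` for ANY β-side antecedent `Hβ`** (`BetaPertHyp D.βfun` below;
`DagBinding.EndpointExistence D.C.toB12` in the print-faithful form) from «for all SMALL-coupling tuned runs and every loop string, a
`TowerExtractionDataLWR` record» (`ForSmallCouplings.mono` ∕ `.underHypotheses` BY NAME; NEITHER `(B)` NOR `Hβ` is read — they would bite inside the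
record's displayed rows, not on this road).  Honest reading: the apex input ⇐ [∀ small-coupling tuned run ∀ string: the extraction displays + the
count + NE7c + NE7 + rates, DISPLAYED].  NE7b NOT proved. [folklore] -/
theorem hybridNE7Under_of_towerExtraction_fsc {Hβ : Prop}
    (hRead : T4ContinuumYM4Torus.ForSmallCouplings D fun g₀ => ∀ os : List (ULoop F),
      ∃ (P : Type) (_ : DecidableEq P) (X : ℕ → ℕ → Type) (𝒢 : (K j : ℕ) → GoodClass (X K j))
        (_ : ∀ K, MeasurableSpace (X K K)) (μ : (K : ℕ) → Measure (X K K)) (_ : ∀ K, IsFiniteMeasure (μ K)),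
        Nonempty (TowerExtractionDataLWR D C O θv rr d n hn g₀ os cΛ M Φ β₀ p₁ η η' κ κ₂ κᵥ P X 𝒢 μ)) :
    T4ApexHybrid.HybridNE7Under D Hβ :=
  (hRead.mono fun _ h => stringwise_of_towerExtraction h).underHypotheses _

end Under

section SU

variable {F : T4Family} {N : ℕ} [NeZero N] {ℰ : LoopAverage (Matrix.specialUnitaryGroup (Fin N) ℂ)}
  {C : T4PrintedShapeBanking.Consts} {O : PrintedO1s} {θv : ℝ} {rr d n : ℕ} {hn : 0 < n} {cΛ M Φ β₀ : ℝ} {p₁ η η' κ κ₂ κᵥ : ℕ}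

/-- **THE HEADLINE PREDICATE FROM A TOWER FAMILY CARRYING THE TWO EXTRACTION DISPLAYS AND THE COUNT**: `ContinuumYM4Torus D` for
(0.4)-block-averaged data on `SU(N)` with a measurable small-loop average, GIVEN the pins `(B) = B16.EndStatementBPrinted D.C` and
`BetaPertHyp D.βfun` BY NAME — consumed HERE ONLY, by `T4ContinuumYM4Torus.continuumYM4Torus_of_targets` (modus ponens on the targets' own
prefix) — and, for all small-coupling tuned runs and every loop string, SOME record `TowerExtractionDataLWR … P X 𝒢 μ` (four carriers); the
ten window letters `cΛ M Φ β₀ p₁ η η′ κ κ₂ κᵥ` are bound here, NO threshold ∕ side-condition binder (the count they priced is displayed).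
Proof: `T4ApexHybrid.targets_of_hybridNE7Under` ∘ `hybridNE7Under_of_towerExtraction_fsc`.  CONDITIONAL on everything the record displays;
NE7b NOT proved; count 0∕9. [folklore] -/
theorem continuumYM4Torus_of_towerExtraction_fsc (D : FiniteEpsData F (Matrix.specialUnitaryGroup (Fin N) ℂ))
    (hBA : D.IsBlockAveraged ℰ) (hE : ℰ.MeasurableE) (hB : B16.EndStatementBPrinted D.C) (hβ : BetaPertHyp D.βfun)
    (hRead : T4ContinuumYM4Torus.ForSmallCouplings D fun g₀ => ∀ os : List (ULoop F),
      ∃ (P : Type) (_ : DecidableEq P) (X : ℕ → ℕ → Type) (𝒢 : (K j : ℕ) → GoodClass (X K j))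
        (_ : ∀ K, MeasurableSpace (X K K)) (μ : (K : ℕ) → Measure (X K K)) (_ : ∀ K, IsFiniteMeasure (μ K)),
        Nonempty (TowerExtractionDataLWR D C O θv rr d n hn g₀ os cΛ M Φ β₀ p₁ η η' κ κ₂ κᵥ P X 𝒢 μ)) :
    T4ContinuumYM4Torus.ContinuumYM4Torus D :=
  T4ContinuumYM4Torus.continuumYM4Torus_of_targets hB hβ
    (T4ApexHybrid.targets_of_hybridNE7Under hBA hE (hybridNE7Under_of_towerExtraction_fsc D hRead))

/-- **THE PRINT-FAITHFUL FORM** (leaf-02 g119's J-X2-1, folded): the same headline with [Balaban1987RG1] Thm 2's ENDPOINT EXISTENCE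
`DagBinding.EndpointExistence D.C.toB12` as the β-side pin in place of `BetaPertHyp` (`T4ApexHybrid.targets'_of_hybridNE7Under'`, then
`T4ContinuumYM4Torus.continuumYM4Torus_of_targets'`); the road is pin-free, so only the modus-ponens step changes. [folklore] -/
theorem continuumYM4Torus_of_towerExtraction_fsc' (D : FiniteEpsData F (Matrix.specialUnitaryGroup (Fin N) ℂ))
    (hBA : D.IsBlockAveraged ℰ) (hE : ℰ.MeasurableE) (hB : B16.EndStatementBPrinted D.C) (hEnd : DagBinding.EndpointExistence D.C.toB12)
    (hRead : T4ContinuumYM4Torus.ForSmallCouplings D fun g₀ => ∀ os : List (ULoop F),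
      ∃ (P : Type) (_ : DecidableEq P) (X : ℕ → ℕ → Type) (𝒢 : (K j : ℕ) → GoodClass (X K j))
        (_ : ∀ K, MeasurableSpace (X K K)) (μ : (K : ℕ) → Measure (X K K)) (_ : ∀ K, IsFiniteMeasure (μ K)),
        Nonempty (TowerExtractionDataLWR D C O θv rr d n hn g₀ os cΛ M Φ β₀ p₁ η η' κ κ₂ κᵥ P X 𝒢 μ)) :
    T4ContinuumYM4Torus.ContinuumYM4Torus D :=
  T4ContinuumYM4Torus.continuumYM4Torus_of_targets' hB hEnd
    (T4ApexHybrid.targets'_of_hybridNE7Under' hBA hE (hybridNE7Under_of_towerExtraction_fsc D hRead))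

end SU

end

end Summit.QuantumFields.BalabanUV.T4Continuum.B16HistoryTowerExtractionEnd
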